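import Summits.AtomisticToContinuum.BoseEinsteinCondensation.Theorems.BECInsertionCorrectorStaticResponseToHMinusOneRealForm
import Summits.AtomisticToContinuum.BoseEinsteinCondensation.Theorems.BECInsertionCorrectorStaticResponseToHMinusOneEnvelope
import Literature.MathematicalPhysics.QuantumManyBody.OneBodyCurrentGain
import HarnessLib

/-!
# Near-minimiser variation for the crux `StaticResponseBound` (stmt-AtomisticToContinuum-12057), I:
# product states `F·Φ/‖F·Φ‖` of a COMPLEX periodic state with a real `C¹` multiplier

Helper file (part 1) for the registered stub `stub_nearMinCosSqMoment` of line `uv-thomson-force-wave`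
(skeleton v4, seat c1): the kill-edge `InfraredHalf ⟹ TorusHyperuniformity (stmt-9093)` tests the crux's
discriminant inequality on the states `(1 + ηV_p)Φ/‖·‖` and `(1 + σV_p²)Φ/‖·‖` built from an ARBITRARY
(complex-valued) finite-energy near-minimiser `Φ`.  This part provides, for a real `C¹` lattice-periodic
Bose-symmetric multiplier `F ≥ 1/2`:

* `kineticDensityReal_eq_gradDot_re_add_im` — `|∇ψ|² = |∇ Re ψ|² + |∇ Im ψ|²` in `gradDot` form;
* `exists_productState` — the normalised state `Ψ_F = c_F · F · Φ`, `c_F > 0`, `c_F² ∫ F²|Φ|² = 1`;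
* `energy_productState` — for a measurable weight `W` computing the periodic energy and `Φ` of finite energy:
  `⟨Ψ,HΨ⟩ < ∞` and `⟨Ψ,HΨ⟩ = T(θΦ) + ∫ W.toReal (θ|Φ|)²` (`θ = c_F F`, `T` the real cell kinetic energy);
* `integral_mul_norm_sq_productState` — `∫ g|Ψ|² = ∫ g (θ|Φ|)²`;
* `cellKineticEnergy_real_mul` — `T(θφ) = ∫ (|∇(θ Re φ)|² + |∇(θ Im φ)|²)` in `gradDot` form.

No definitions; real Bochner bookkeeping only.  References: [ReedSimonIV1978] §XIII.1 (Rayleigh quotients);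
[Davies1989] §4.2 (ground-state transform for products).
-/

noncomputable section

namespace Summit.AtomisticToContinuum.BoseEinsteinCondensation.Cruxes.StaticResponseBound.UvThomsonForceWave

open MeasureTheory Filter
open scoped ENNReal NNReal BigOperators Topology
open Literature.MathematicalPhysics.QuantumManyBody.BoseGas
open Summit.AtomisticToContinuum.BoseEinsteinCondensation.Theorems.StaticResponseBound.Negative
open Summit.AtomisticToContinuum.BoseEinsteinCondensation.Theorems.StaticResponseToHMinusOne
  (ae_weight_mul_ofReal_eq integrableOn_toReal_weight_mul_norm_sq)

variable {N : ℕ} {L : ℝ}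

/-! ### Real and imaginary parts of a differentiable wave function -/

/-- The partial derivative of `Re ψ` is the real part of the complex partial derivative. [folklore] -/
theorem pderiv_re_apply {ψ : Config N → ℂ} {X : Config N} (hψ : DifferentiableAt ℝ ψ X)
    (i : Fin N) (a : Fin 3) :
    pderiv i a (fun Y => (ψ Y).re) X = (fderiv ℝ ψ X (Pi.single i (EuclideanSpace.single a 1))).re := by
  have hre : fderiv ℝ (fun Y => (ψ Y).re) X = Complex.reCLM.comp (fderiv ℝ ψ X) :=
    (Complex.reCLM.hasFDerivAt.comp X hψ.hasFDerivAt).fderiv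
  unfold pderiv
  rw [hre]
  rfl

/-- The partial derivative of `Im ψ` is the imaginary part of the complex partial derivative. [folklore] -/
theorem pderiv_im_apply {ψ : Config N → ℂ} {X : Config N} (hψ : DifferentiableAt ℝ ψ X)
    (i : Fin N) (a : Fin 3) :
    pderiv i a (fun Y => (ψ Y).im) X = (fderiv ℝ ψ X (Pi.single i (EuclideanSpace.single a 1))).im := by
  have him : fderiv ℝ (fun Y => (ψ Y).im) X = Complex.imCLM.comp (fderiv ℝ ψ X) :=
    (Complex.imCLM.hasFDerivAt.comp X hψ.hasFDerivAt).fderiv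
  unfold pderiv
  rw [him]
  rfl

/-- **`|∇ψ|² = |∇ Re ψ|² + |∇ Im ψ|²`** in `gradDot` form, at a point of differentiability. [folklore] -/
theorem kineticDensityReal_eq_gradDot_re_add_im {ψ : Config N → ℂ} {X : Config N}
    (hψ : DifferentiableAt ℝ ψ X) :
    kineticDensityReal ψ X =
      gradDot (fun Y => (ψ Y).re) (fun Y => (ψ Y).re) X +
        gradDot (fun Y => (ψ Y).im) (fun Y => (ψ Y).im) X := by
  unfold kineticDensityReal gradDot
  rw [← Finset.sum_add_distrib]
  refine Finset.sum_congr rfl fun i _ => ?_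
  rw [← Finset.sum_add_distrib]
  refine Finset.sum_congr rfl fun a _ => ?_
  rw [pderiv_re_apply hψ, pderiv_im_apply hψ, Complex.sq_norm, Complex.normSq_apply]

/-- The real part of `θ φ` for a real multiplier. [folklore] -/
theorem re_ofReal_mul_fun (θ : Config N → ℝ) (φ : Config N → ℂ) :
    (fun Y => (((θ Y : ℝ) : ℂ) * φ Y).re) = fun Y => θ Y * (φ Y).re := by
  funext Y
  rw [Complex.re_ofReal_mul]

/-- The imaginary part of `θ φ` for a real multiplier. [folklore] -/
theorem im_ofReal_mul_fun (θ : Config N → ℝ) (φ : Config N → ℂ) :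
    (fun Y => (((θ Y : ℝ) : ℂ) * φ Y).im) = fun Y => θ Y * (φ Y).im := by
  funext Y
  rw [Complex.im_ofReal_mul]

/-- **Kinetic energy of a real multiple of a complex function**: for real `C¹` `θ` and complex `C¹` `φ`,
`T(θφ) = ∫_cell (|∇(θ Re φ)|² + |∇(θ Im φ)|²)`. [folklore] -/
theorem cellKineticEnergy_real_mul {θ : Config N → ℝ} (hθ : ContDiff ℝ 1 θ) {φ : Config N → ℂ}
    (hφ : ContDiff ℝ 1 φ) (L : ℝ) :
    cellKineticEnergy L (fun Y => ((θ Y : ℝ) : ℂ) * φ Y) =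
      ∫ X in cellN N L,
        (gradDot (fun Y => θ Y * (φ Y).re) (fun Y => θ Y * (φ Y).re) X +
          gradDot (fun Y => θ Y * (φ Y).im) (fun Y => θ Y * (φ Y).im) X) := by
  unfold cellKineticEnergy
  have hd : Differentiable ℝ fun Y => ((θ Y : ℝ) : ℂ) * φ Y :=
    ((Complex.ofRealCLM.contDiff.comp hθ).mul hφ).differentiable one_ne_zero
  refine integral_congr_ae (ae_of_all _ fun X => ?_)
  rw [kineticDensityReal_eq_gradDot_re_add_im (hd X), re_ofReal_mul_fun, im_ofReal_mul_fun]

/-! ### Product states `Ψ_F = F·Φ/‖F·Φ‖` -/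

/-- The squared modulus of `θ·Φ` for a real multiplier: `‖θΦ‖² = (θ|Φ|)²`. [folklore] -/
theorem norm_sq_ofReal_mul (θ : ℝ) (z : ℂ) : ‖((θ : ℂ)) * z‖ ^ 2 = (θ * ‖z‖) ^ 2 := by
  rw [norm_mul, Complex.norm_real, Real.norm_eq_abs, mul_pow, mul_pow, sq_abs]

/-- **Admissible product states.** For a periodic trial state `Φ` and a real `C¹` lattice-periodic
Bose-symmetric multiplier `F` with `F ≥ 1/2` everywhere, `F·Φ` normalised on the cell is an admissible
periodic trial state `Ψ = (c F)·Φ` with `c > 0` and `c² ∫_cell F²|Φ|² = 1`. [folklore] -/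
theorem exists_productState (Φ : PeriodicTrialState N L) {F : Config N → ℝ} (hF : ContDiff ℝ 1 F)
    (hFper : IsLatticePeriodic L F) (hFsymm : ∀ (σ : Equiv.Perm (Fin N)) (X : Config N), F (X ∘ σ) = F X)
    (hFpos : ∀ X, 1 / 2 ≤ F X) :
    ∃ Ψ : PeriodicTrialState N L, ∃ c : ℝ, 0 < c ∧
      (∀ X, Ψ.ψ X = (((c * F X : ℝ)) : ℂ) * Φ.ψ X) ∧
      c ^ 2 * ∫ X in cellN N L, F X ^ 2 * ‖Φ.ψ X‖ ^ 2 = 1 := by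
  set ψF : Config N → ℂ := fun X => ((F X : ℝ) : ℂ) * Φ.ψ X with hψF
  have hC : ContDiff ℝ 1 ψF := (Complex.ofRealCLM.contDiff.comp hF).mul Φ.contDiff
  have hper : ∀ (X : Config N) (i : Fin N) (a : Fin 3),
      ψF (X + Pi.single i (EuclideanSpace.single a L)) = ψF X := by
    intro X i a; simp only [hψF, hFper X i a, Φ.periodic X i a]
  have hsymm : ∀ (σ : Equiv.Perm (Fin N)) (X : Config N), ψF (X ∘ σ) = ψF X := by
    intro σ X; simp only [hψF, hFsymm σ X, Φ.symm σ X]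
  -- `|ψF|² ≥ |Φ|²/4` pointwise, hence the mass is at least `1/4`
  have hptle : ∀ X, ENNReal.ofReal (1 / 4) * ((‖Φ.ψ X‖₊ : ℝ≥0∞)) ^ 2 ≤ ((‖ψF X‖₊ : ℝ≥0∞)) ^ 2 := by
    intro X
    rw [coe_nnnorm_sq_eq_ofReal, coe_nnnorm_sq_eq_ofReal, ← ENNReal.ofReal_mul (by norm_num)]
    refine ENNReal.ofReal_le_ofReal ?_
    simp only [hψF]
    rw [norm_sq_ofReal_mul]
    have h := hFpos X
    have hn := norm_nonneg (Φ.ψ X)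
    nlinarith [sq_nonneg (‖Φ.ψ X‖), mul_self_nonneg (F X - 1 / 2)]
  have hmass : ENNReal.ofReal (1 / 4) ≤ ∫⁻ X in cellN N L, ((‖ψF X‖₊ : ℝ≥0∞)) ^ 2 := by
    calc ENNReal.ofReal (1 / 4)
        = ENNReal.ofReal (1 / 4) * ∫⁻ X in cellN N L, ((‖Φ.ψ X‖₊ : ℝ≥0∞)) ^ 2 := by
          rw [Φ.norm_eq, mul_one]
      _ = ∫⁻ X in cellN N L, ENNReal.ofReal (1 / 4) * ((‖Φ.ψ X‖₊ : ℝ≥0∞)) ^ 2 :=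
          (lintegral_const_mul' _ _ ENNReal.ofReal_ne_top).symm
      _ ≤ ∫⁻ X in cellN N L, ((‖ψF X‖₊ : ℝ≥0∞)) ^ 2 := lintegral_mono fun X => hptle X
  have h0 : ∫⁻ X in cellN N L, ((‖ψF X‖₊ : ℝ≥0∞)) ^ 2 ≠ 0 := by
    intro h0
    rw [h0, nonpos_iff_eq_zero, ENNReal.ofReal_eq_zero] at hmass
    norm_num at hmass
  have htop : ∫⁻ X in cellN N L, ((‖ψF X‖₊ : ℝ≥0∞)) ^ 2 ≠ ⊤ :=
    lintegral_cellN_normSq_ne_top hC.continuous L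
  have hc : 0 < (Real.sqrt (∫⁻ X in cellN N L, ((‖ψF X‖₊ : ℝ≥0∞)) ^ 2).toReal)⁻¹ :=
    inv_pos.2 (Real.sqrt_pos.2 (ENNReal.toReal_pos h0 htop))
  have hΨ : ∀ X, (PeriodicTrialState.ofFun ψF hC hper hsymm h0 htop).ψ X =
      ((((Real.sqrt (∫⁻ X in cellN N L, ((‖ψF X‖₊ : ℝ≥0∞)) ^ 2).toReal)⁻¹ * F X : ℝ)) : ℂ) *
        Φ.ψ X := by
    intro X
    rw [PeriodicTrialState.ofFun_apply]
    simp only [hψF]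
    push_cast
    ring
  refine ⟨PeriodicTrialState.ofFun ψF hC hper hsymm h0 htop, _, hc, hΨ, ?_⟩
  have h := integral_norm_sq_eq_one (PeriodicTrialState.ofFun ψF hC hper hsymm h0 htop)
  have hpt : ∀ X, ‖(PeriodicTrialState.ofFun ψF hC hper hsymm h0 htop).ψ X‖ ^ 2 =
      ((Real.sqrt (∫⁻ X in cellN N L, ((‖ψF X‖₊ : ℝ≥0∞)) ^ 2).toReal)⁻¹) ^ 2 *
        (F X ^ 2 * ‖Φ.ψ X‖ ^ 2) := fun X => by
    rw [hΨ X, norm_sq_ofReal_mul]; ring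
  simp_rw [hpt] at h
  rwa [integral_const_mul] at h

/-- **Energy of a product state.** Let `W` be a measurable weight computing the periodic energy, `Φ` a
periodic state of finite energy (complex values, zeros allowed), `θ` a real `C¹` function and `Ψ` a periodic
state with `Ψ = θ·Φ` pointwise.  Then `⟨Ψ,HΨ⟩ < ∞` and
`⟨Ψ,HΨ⟩ = T(Ψ) + ∫_cell W.toReal (θ|Φ|)²` as real numbers. [folklore] -/
theorem energy_productState' {v : ℝ → ℝ≥0∞} {W : Config N → ℝ≥0∞} (hW : Measurable W)
    (hEW : ∀ Ψ : PeriodicTrialState N L, periodicEnergy v Ψ =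
      ∫⁻ X in cellN N L, kineticDensity Ψ.ψ X + W X * ((‖Ψ.ψ X‖₊ : ℝ≥0∞)) ^ 2)
    (Φ : PeriodicTrialState N L) (hfin : periodicEnergy v Φ ≠ ⊤) (Ψ : PeriodicTrialState N L)
    {θ : Config N → ℝ} (hθ : ContDiff ℝ 1 θ) (hΨ : ∀ X, Ψ.ψ X = ((θ X : ℝ) : ℂ) * Φ.ψ X) :
    periodicEnergy v Ψ ≠ ⊤ ∧
      (periodicEnergy v Ψ).toReal =
        cellKineticEnergy L Ψ.ψ + ∫ X in cellN N L, (W X).toReal * (θ X * ‖Φ.ψ X‖) ^ 2 := by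
  have hfin' : (∫⁻ X in cellN N L, kineticDensity Φ.ψ X + W X * ((‖Φ.ψ X‖₊ : ℝ≥0∞)) ^ 2) ≠ ⊤ := by
    rw [← hEW Φ]; exact hfin
  -- pointwise form of the potential integrand
  have hpt : ∀ X, W X * ((‖Ψ.ψ X‖₊ : ℝ≥0∞)) ^ 2 = W X * ENNReal.ofReal ((θ X * ‖Φ.ψ X‖) ^ 2) := by
    intro X
    rw [coe_nnnorm_sq_eq_ofReal, hΨ X, norm_sq_ofReal_mul]
  -- integrability of the real potential density
  obtain ⟨M, -, hM⟩ := exists_bound_on_cellN hθ.continuous L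
  have hint2 : IntegrableOn (fun X => (W X).toReal * (θ X * ‖Φ.ψ X‖) ^ 2) (cellN N L) := by
    have h0 := integrableOn_toReal_weight_mul_norm_sq (Θ := Φ) hW hfin'
    have hfun : (fun X => (W X).toReal * (θ X * ‖Φ.ψ X‖) ^ 2) =
        fun X => θ X ^ 2 * ((W X).toReal * ‖Φ.ψ X‖ ^ 2) := by
      funext X; ring
    rw [hfun]
    refine Integrable.bdd_mul h0 ((hθ.continuous.pow 2).aestronglyMeasurable) (c := M ^ 2) ?_
    rw [ae_restrict_iff' (measurableSet_cellN N L)]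
    refine ae_of_all _ fun X hX => ?_
    rw [Real.norm_eq_abs, abs_pow]
    have h1 := hM X hX
    have h2 := abs_nonneg (θ X)
    nlinarith
  have e2 : ∫⁻ X in cellN N L, W X * ENNReal.ofReal ((θ X * ‖Φ.ψ X‖) ^ 2) =
      ENNReal.ofReal (∫ X in cellN N L, (W X).toReal * (θ X * ‖Φ.ψ X‖) ^ 2) := by
    rw [ofReal_integral_eq_lintegral_ofReal hint2
      (ae_of_all _ fun X => mul_nonneg ENNReal.toReal_nonneg (sq_nonneg _))]
    exact lintegral_congr_ae (ae_weight_mul_ofReal_eq hW hfin' θ)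
  have hE : periodicEnergy v Ψ = ENNReal.ofReal (cellKineticEnergy L Ψ.ψ +
      ∫ X in cellN N L, (W X).toReal * (θ X * ‖Φ.ψ X‖) ^ 2) := by
    rw [hEW Ψ]
    simp_rw [hpt]
    rw [lintegral_add_left (kineticDensity_measurable Ψ.ψ), lintegral_kineticDensity_eq Ψ.contDiff L, e2,
      ← ENNReal.ofReal_add (cellKineticEnergy_nonneg L Ψ.ψ)
        (integral_nonneg fun X => mul_nonneg ENNReal.toReal_nonneg (sq_nonneg _))]
  refine ⟨by rw [hE]; exact ENNReal.ofReal_ne_top, ?_⟩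
  rw [hE, ENNReal.toReal_ofReal]
  exact add_nonneg (cellKineticEnergy_nonneg L Ψ.ψ)
    (integral_nonneg fun X => mul_nonneg ENNReal.toReal_nonneg (sq_nonneg _))

/-- **Energy of a product state** (registered helper form `energy_productState`, sub-goal 1/3 of the stub
`stub_nearMinCosSqMoment`): verbatim `energy_productState'` with all binders explicit. [folklore] -/
theorem energy_productState : ∀ {N : ℕ} {L : ℝ} {v : ℝ → ℝ≥0∞} {W : Config N → ℝ≥0∞}, Measurable W →
    (∀ Ψ : PeriodicTrialState N L, periodicEnergy v Ψ =
      ∫⁻ X in cellN N L, kineticDensity Ψ.ψ X + W X * ((‖Ψ.ψ X‖₊ : ℝ≥0∞)) ^ 2) →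
    ∀ (Φ : PeriodicTrialState N L), periodicEnergy v Φ ≠ ⊤ →
    ∀ (Ψ : PeriodicTrialState N L) {θ : Config N → ℝ}, ContDiff ℝ 1 θ →
    (∀ X, Ψ.ψ X = ((θ X : ℝ) : ℂ) * Φ.ψ X) →
    periodicEnergy v Ψ ≠ ⊤ ∧ (periodicEnergy v Ψ).toReal =
      cellKineticEnergy L Ψ.ψ + ∫ X in cellN N L, (W X).toReal * (θ X * ‖Φ.ψ X‖) ^ 2 :=
  fun hW hEW Φ hfin Ψ _ hθ hΨ => energy_productState' hW hEW Φ hfin Ψ hθ hΨ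

/-- Weighted moments of a product state: `∫ g|Ψ|² = ∫ g (θ|Φ|)²` for `Ψ = θ·Φ`. [folklore] -/
theorem integral_mul_norm_sq_productState (g : Config N → ℝ) (Φ Ψ : PeriodicTrialState N L)
    {θ : Config N → ℝ} (hΨ : ∀ X, Ψ.ψ X = ((θ X : ℝ) : ℂ) * Φ.ψ X) :
    ∫ X in cellN N L, g X * ‖Ψ.ψ X‖ ^ 2 = ∫ X in cellN N L, g X * (θ X * ‖Φ.ψ X‖) ^ 2 := by
  refine integral_congr_ae (ae_of_all _ fun X => ?_)
  dsimp only
  rw [hΨ X, norm_sq_ofReal_mul]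

/-- **Energy of the state itself in real form** (`θ = 1`): `⟨Φ,HΦ⟩ = T(Φ) + ∫ W.toReal |Φ|²` for a
finite-energy `Φ`. [folklore] -/
theorem toReal_energy_eq {v : ℝ → ℝ≥0∞} {W : Config N → ℝ≥0∞} (hW : Measurable W)
    (hEW : ∀ Ψ : PeriodicTrialState N L, periodicEnergy v Ψ =
      ∫⁻ X in cellN N L, kineticDensity Ψ.ψ X + W X * ((‖Ψ.ψ X‖₊ : ℝ≥0∞)) ^ 2)
    (Φ : PeriodicTrialState N L) (hfin : periodicEnergy v Φ ≠ ⊤) :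
    (periodicEnergy v Φ).toReal =
      cellKineticEnergy L Φ.ψ + ∫ X in cellN N L, (W X).toReal * ‖Φ.ψ X‖ ^ 2 := by
  have h := (energy_productState' hW hEW Φ hfin Φ (θ := fun _ => (1 : ℝ)) contDiff_const
    (fun X => by simp)).2
  simpa using h

end Summit.AtomisticToContinuum.BoseEinsteinCondensation.Cruxes.StaticResponseBound.UvThomsonForceWave

end
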